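import Mathlib
import Summits.Ventures.HodgeRepro.Tier4.Line4.MainTermSplitInvariance
import Summits.Ventures.HodgeRepro.Tier4.Line4.AwayDomain
import Summits.Ventures.HodgeRepro.Tier4.Line4.SuppMeasureTranslate

/-!
# Tier4/Line4/AwayOrbitalDomain — C-L4-AWAY-DOMAIN-FREE: the away orbital integral `awayOrbital` does not depend on the
`centreAway`-fundamental domain

Blind re-derivation cell `pub-hodge-repro`, Tier 4 «prove the step» (README §9–§10), seat t4-L2-p2 (gen 6; the cut
suggested at S16169, unowned after L4-x2 g0's close S16234 — taken by this seat).  Tree path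
`lean/Summits/Ventures/HodgeRepro/Tier4/Line4/AwayOrbitalDomain.lean`.  Imports x2's `Line4/MainTermSplitInvariance`
(`coe_centreFin_mem_centre`, `exists_torusFin'_coe_eq_of_mem_centre`, `chi_mul_conj_chi'_eq_one`; through it
`Line4/MainTermSplit`: `awayOrbital`, `levelDCAway`) and this seat's `Line4/AwayDomain` (`offPlacesPart_mem_centre`,
`awayTfHom_coe`; through it L2-p1's PlacePart / TorusFinSplit / ZDomainSplit: `coe_awayTf`, `coe_awayTf'`,
`offPlacesPart_eq_self_of_mem_trivialOn`, `centreAway`) and L2-p3's `Line4/SuppMeasureTranslate` (`countable_centreFin`).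
Mathlib-level; no literature; no `def`.

WHAT.  For `z ∈ centreAway W S` (the image of the rational centre `Z(k) ⊆ T_f` in the away torus `T_f^{(S)}`), the adelic
element of `z` is the away part of a central element, hence central in `G(𝔸)` (`offPlacesPart_mem_centre`), and it has a
copy `z′ ∈ T′_f^{(S)}` (the same adelic element: `exists_torusFin'_coe_eq_of_mem_centre` + `awayTf'`).  The integrand of
`awayOrbital`, `F y := χ(y) · ∫ y′, conj χ′(y′) · levelDCAway (y⁻¹ γ₀,f y′) dν′_A`, is then `centreAway`-invariant:
`F (z y) = χ(z) χ(y) · ∫ y′, conj χ′(z′ y′) · levelDCAway (y⁻¹ z⁻¹ γ₀,f z′ y′) = χ(z) conj χ′(z′) · F y = F y`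
(`y′ ↦ z′ y′` by the left invariance of the Haar `ν′_A`, `z⁻¹ γ₀,f z′ = γ₀,f` since `z′ = z` is central, and
`χ(z) conj χ′(z′) = 1`: `chi_mul_conj_chi'_eq_one`).  Mathlib's `IsFundamentalDomain.setIntegral_eq` then gives
`awayOrbital … DZA = awayOrbital … DZA′` for any two `centreAway`-fundamental domains — (S-FIN-NV)'s display `haway` may
be asked at one domain or at all of them (TailSeesawDomain's ∀-form, S16243), the two are equivalent.

Nothing here says anything about the status of the Hodge conjecture for CM abelian varieties, which is NOT proved
(HC_CM is NOT proved by anyone in this repository).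
-/

set_option autoImplicit false

noncomputable section

namespace Summit.Ventures.HodgeRepro.Tier4.Line4

open Summit.Ventures.HodgeRepro.Tier4 Summit.Ventures.HodgeRepro.Tier4.Common Summit.Ventures.HodgeRepro.Tier4.Line1
  MeasureTheory NumberField IsDedekindDomain

open scoped ComplexConjugate NumberField Pointwise

section Central

variable {k : Type} [Field k] [NumberField k] (W : PlaneData k) (S : Set (HeightOneSpectrum (𝓞 k)))

/-- **An element of `centreAway` is central in `G(𝔸)` and has a copy in `T′_f^{(S)}`** (the same adelic element). -/
theorem mem_centre_and_exists_torusFinAway'_coe_eq_of_mem_centreAway (z : torusFinAway W S)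
    (hz : z ∈ centreAway W S) :
    (((z : torusFin W) : torusT W) : GA W) ∈ centre W ∧
      ∃ z' : torusFinAway' W S, (((z' : torusFin' W) : torusT' W) : GA W) = (((z : torusFin W) : torusT W) : GA W) := by
  obtain ⟨ζ, hζ, rfl⟩ := hz
  have hζc : ((ζ : torusT W) : GA W) ∈ centre W := coe_centreFin_mem_centre W hζ
  have hcoe : (((awayTfHom W S ζ : torusFin W) : torusT W) : GA W) = GA.offPlacesPart W S ((ζ : torusT W) : GA W) := by
    rw [awayTfHom_apply]
    exact coe_awayTf W S ζ
  have hcen : (((awayTfHom W S ζ : torusFin W) : torusT W) : GA W) ∈ centre W := by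
    rw [hcoe]
    exact offPlacesPart_mem_centre W S hζc
  refine ⟨hcen, ?_⟩
  obtain ⟨z₁, hz₁⟩ := exists_torusFin'_coe_eq_of_mem_centre W (awayTfHom W S ζ : torusFin W) hcen
  refine ⟨awayTf' W S z₁, ?_⟩
  rw [coe_awayTf', hz₁, hcoe]
  exact offPlacesPart_eq_self_of_mem_trivialOn W S (offPlacesPart_mem_finitePart W S _)
    (offPlacesPart_mem_trivialOn W S _)

end Central

section Invariance

variable {k : Type} [Field k] [NumberField k] (W : PlaneData k) (S : Set (HeightOneSpectrum (𝓞 k)))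
  [MeasurableSpace (GA W)] [BorelSpace (GA W)] (R : RTFData W) (γ₀ : GA W)

/-- **The away inner integral at a central translate**: for `z ∈ centreAway` with its copy `z′ ∈ T′_f^{(S)}`,
`J(z y) = conj χ′(z′) · J(y)` where `J(y) := ∫ y′, conj χ′(y′) · levelDCAway (y⁻¹ γ₀,f y′) dν′_A`. -/
theorem awayInner_mul_left (νA' : Measure (torusFinAway' W S)) [νA'.IsHaarMeasure] (z : torusFinAway W S)
    (hz : (((z : torusFin W) : torusT W) : GA W) ∈ centre W) (z' : torusFinAway' W S)
    (hz' : (((z' : torusFin' W) : torusT' W) : GA W) = (((z : torusFin W) : torusT W) : GA W)) (y : torusFinAway W S) :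
    (∫ y' : torusFinAway' W S, conj (R.chi' ((y' : torusFin' W) : torusT' W)) *
        levelDCAway W S γ₀ 1 (((((z * y : torusFinAway W S) : torusFin W) : torusT W) : GA W)⁻¹ * GA.ofFinPart W γ₀ *
          (((y' : torusFin' W) : torusT' W) : GA W)) ∂νA') =
      conj (R.chi' ((z' : torusFin' W) : torusT' W)) *
        ∫ y' : torusFinAway' W S, conj (R.chi' ((y' : torusFin' W) : torusT' W)) *
          levelDCAway W S γ₀ 1 ((((y : torusFin W) : torusT W) : GA W)⁻¹ * GA.ofFinPart W γ₀ *
            (((y' : torusFin' W) : torusT' W) : GA W)) ∂νA' := by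
  haveI := secondCountable_GA W
  haveI : BorelSpace (torusT' W) := Subtype.borelSpace _
  haveI : BorelSpace (torusFin' W) := Subtype.borelSpace _
  haveI : BorelSpace (torusFinAway' W S) := Subtype.borelSpace _
  have hcomm : ∀ g : GA W, g * (((z : torusFin W) : torusT W) : GA W) = (((z : torusFin W) : torusT W) : GA W) * g :=
    fun g => Subgroup.mem_center_iff.1 (centre_le_center W hz) g
  rw [← integral_mul_left_eq_self _ z', ← integral_const_mul]
  refine integral_congr_ae (Filter.Eventually.of_forall fun y' => ?_)
  dsimp only
  simp only [Subgroup.coe_mul, R.chi'_mul, map_mul, hz', mul_inv_rev, mul_assoc]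
  rw [← mul_assoc (GA.ofFinPart W γ₀), hcomm (GA.ofFinPart W γ₀)]
  simp only [mul_assoc, inv_mul_cancel_left]

/-- **THE AWAY INTEGRAND IS `centreAway`-INVARIANT**: for `z ∈ centreAway`, `χ(z y) · J(z y) = χ(y) · J(y)`. -/
theorem chi_mul_awayInner_centreAway_mul (hu : ∀ a, ‖R.chi a‖ = 1) (νA' : Measure (torusFinAway' W S))
    [νA'.IsHaarMeasure] (z : torusFinAway W S) (hz : z ∈ centreAway W S) (y : torusFinAway W S) :
    R.chi (((z * y : torusFinAway W S) : torusFin W) : torusT W) *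
        (∫ y' : torusFinAway' W S, conj (R.chi' ((y' : torusFin' W) : torusT' W)) *
          levelDCAway W S γ₀ 1 (((((z * y : torusFinAway W S) : torusFin W) : torusT W) : GA W)⁻¹ * GA.ofFinPart W γ₀ *
            (((y' : torusFin' W) : torusT' W) : GA W)) ∂νA') =
      R.chi (((y : torusFin W) : torusT W)) *
        ∫ y' : torusFinAway' W S, conj (R.chi' ((y' : torusFin' W) : torusT' W)) *
          levelDCAway W S γ₀ 1 ((((y : torusFin W) : torusT W) : GA W)⁻¹ * GA.ofFinPart W γ₀ *
            (((y' : torusFin' W) : torusT' W) : GA W)) ∂νA' := by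
  obtain ⟨hcen, z', hz'⟩ := mem_centre_and_exists_torusFinAway'_coe_eq_of_mem_centreAway W S z hz
  rw [awayInner_mul_left W S R γ₀ νA' z hcen z' hz' y, Subgroup.coe_mul, Subgroup.coe_mul, R.chi_mul]
  have h1 := chi_mul_conj_chi'_eq_one W R hu (z : torusFin W) hcen (z' : torusFin' W) hz'
  calc R.chi ((z : torusFin W) : torusT W) * R.chi ((y : torusFin W) : torusT W) *
        (conj (R.chi' ((z' : torusFin' W) : torusT' W)) *
          ∫ y' : torusFinAway' W S, conj (R.chi' ((y' : torusFin' W) : torusT' W)) *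
            levelDCAway W S γ₀ 1 ((((y : torusFin W) : torusT W) : GA W)⁻¹ * GA.ofFinPart W γ₀ *
              (((y' : torusFin' W) : torusT' W) : GA W)) ∂νA')
      = (R.chi ((z : torusFin W) : torusT W) * conj (R.chi' ((z' : torusFin' W) : torusT' W))) *
          (R.chi ((y : torusFin W) : torusT W) *
            ∫ y' : torusFinAway' W S, conj (R.chi' ((y' : torusFin' W) : torusT' W)) *
              levelDCAway W S γ₀ 1 ((((y : torusFin W) : torusT W) : GA W)⁻¹ * GA.ofFinPart W γ₀ *
                (((y' : torusFin' W) : torusT' W) : GA W)) ∂νA') := by ring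
    _ = _ := by rw [h1, one_mul]

/-- **`awayOrbital` does not depend on the `centreAway`-fundamental domain** (Mathlib's
`IsFundamentalDomain.setIntegral_eq` on the invariant integrand). -/
theorem awayOrbital_eq_of_isFundamentalDomain (hu : ∀ a, ‖R.chi a‖ = 1) (νA : Measure (torusFinAway W S))
    [νA.IsHaarMeasure] (νA' : Measure (torusFinAway' W S)) [νA'.IsHaarMeasure] {DZA DZA' : Set (torusFinAway W S)}
    (h : IsFundamentalDomain (centreAway W S) DZA νA) (h' : IsFundamentalDomain (centreAway W S) DZA' νA) :
    awayOrbital W S R γ₀ νA νA' DZA = awayOrbital W S R γ₀ νA νA' DZA' := by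
  haveI := secondCountable_GA W
  haveI : BorelSpace (torusT W) := Subtype.borelSpace _
  haveI : BorelSpace (torusFin W) := Subtype.borelSpace _
  haveI : BorelSpace (torusFinAway W S) := Subtype.borelSpace _
  haveI : MeasurableMul (torusFinAway W S) :=
    ⟨fun c => (continuous_const.mul continuous_id).measurable, fun c => (continuous_id.mul continuous_const).measurable⟩
  haveI : νA.IsMulLeftInvariant := inferInstance
  haveI : SMulInvariantMeasure (torusFinAway W S) (torusFinAway W S) νA := ⟨fun c _ _ => measure_preimage_mul νA c _⟩
  haveI : SMulInvariantMeasure (centreAway W S) (torusFinAway W S) νA := Subgroup.smulInvariantMeasure _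
  haveI : MeasurableConstSMul (torusFinAway W S) (torusFinAway W S) := ⟨fun c => measurable_const_mul c⟩
  haveI : MeasurableConstSMul (centreAway W S) (torusFinAway W S) := ⟨fun c => measurable_const_mul (c : torusFinAway W S)⟩
  haveI : Countable (centreAway W S) := by
    haveI : Countable (centreFin W) := countable_centreFin W
    have hc : (centreAway W S : Set (torusFinAway W S)).Countable := by
      rw [centreAway, Subgroup.coe_map]
      exact (Set.countable_coe_iff.1 inferInstance).image _
    exact hc.to_subtype
  unfold awayOrbital
  refine h.setIntegral_eq h' fun z y => ?_
  rw [Subgroup.smul_def, smul_eq_mul]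
  exact chi_mul_awayInner_centreAway_mul W S R γ₀ hu νA' (z : torusFinAway W S) z.2 y

/-- **(S-FIN-NV)'s display at ONE fundamental domain gives it at EVERY fundamental domain** — the bridge from the
one-domain `haway` of TailSeesawHaar to the ∀-form of TailSeesawDomain. -/
theorem awayOrbital_ne_zero_forall_of_ne_zero (hu : ∀ a, ‖R.chi a‖ = 1) (νA : Measure (torusFinAway W S))
    [νA.IsHaarMeasure] (νA' : Measure (torusFinAway' W S)) [νA'.IsHaarMeasure] {DZA : Set (torusFinAway W S)}
    (h : IsFundamentalDomain (centreAway W S) DZA νA) (hne : awayOrbital W S R γ₀ νA νA' DZA ≠ 0) :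
    ∀ DZA' : Set (torusFinAway W S), MeasurableSet DZA' → IsFundamentalDomain (centreAway W S) DZA' νA →
      awayOrbital W S R γ₀ νA νA' DZA' ≠ 0 := by
  intro DZA' _ h'
  rw [← awayOrbital_eq_of_isFundamentalDomain W S R γ₀ hu νA νA' h h']
  exact hne

end Invariance

end Summit.Ventures.HodgeRepro.Tier4.Line4

end
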